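import Literature.NumberTheory.DiophantineGeometry.GenEllConjugateCompactness
import Mathlib.Analysis.Normed.Group.Ultra
import Mathlib.Analysis.Normed.Module.FiniteDimension
import Mathlib.NumberTheory.Padics.ProperSpace
import HarnessLib

/-!
# `p`-adic separation from the ramification locus bounds `‖N_c(P)‖_p` below — the FAMILY `t_c`
# (GenEllTwo, W5b-padic, `c`-parametric twin of `GenEllDeRamificationPadic.lean`)

Support for `Summit.ABC.ABC.Theses.IUTThetaPilot.GenEllTwo` = [GenEll] Thm. 2.1 (ii) ⇒ (i) for
`(ℙ¹, [0]+[1]+[∞])` (S. Mochizuki, *Arithmetic elliptic curves in general position*, Math. J. Okayama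
Univ. 52 (2010), Thm. 2.1, proof p. 12: "the compactness of the set of rational points of `X` over
any finite extension of `ℚ_v` for `v ∈ V`" [cite: MochizukiGenEll2010]), in the abc-iut cell's
number-field-only architecture (`GENELLTWO-P1ROUTE.md` §2–§3) as amended by the package owner's
RULING #6 + AMENDMENT (2026-08-26): the primary route uses the ONE-PARAMETER FAMILY of noncritical
coordinates `t_c := 1/r + c·r^{k+1}/s` (`c ∈ ℚ^×`) on `D_e : r^{2k+1} = x(1 − x)` (`s = 1 − 2x`,
`e = 2k+1`), so that the unprotectable finite sets `x(t_c⁻¹(crit t_c))` are pairwise disjoint, and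
«W5 must be stated for the family `t_c`». The ramification function of `t_c` is

  `N_c = r²s³·dt_c/dr = −(1−2x)³ + c·((k+1)r^{k+2} − 2r^{3k+3})`

(the W5 coordinator's normal form; `c = 1` is `GenEllDeRamificationPadic`'s `N`). This file is the
`c`-parametric twin of `GenEllDeRamificationPadic.lean` (author abc-iut-w5-d071): every statement and
proof is the one there with `c` threaded through; the only new phenomenon is that the growth bound
depends on `‖c‖_p` (which may be small):

* `DePadicC.norm_snd_le`, `DePadicC.norm_fst_le` — ultrametric growth: on `D_e` over an ultrametric
  field with `‖2‖ ≥ 1/2` and `c ≠ 0`, `‖N_c‖ ≤ 1 ⇒ ‖r‖ ≤ max 4 ‖c‖⁻¹ ⇒ ‖x‖ ≤ (max 4 ‖c‖⁻¹)^{2k+1}`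
  (the term `2c·r^{3k+3}` strictly dominates as soon as `‖r‖ > 4` and `‖c‖·‖r‖ > 1`);
* `DePadicC.exists_pos_le_norm_of_separated` — for `c ∈ ℚ̄_p^×`, a finite `L ⊆ ℚ̄_p` over `ℚ_p` and
  `ρ > 0`: `∃ c₀ > 0`, every `P ∈ D_e(L)` whose `ρ`-neighbourhood in `ℚ̄_p²` contains no zero of
  `N_c` on `D_e(ℚ̄_p)` has `c₀ ≤ ‖N_c(P)‖` (compactness of `{‖N_c‖ ≤ 1} ∩ D_e(L)`);
* `DePadicC.exists_pos_le_norm_embedding_of_separated` (+ `_of_subset`) — **for `c ∈ ℚ^×` and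
  number fields `F` with `[F:ℚ] ≤ d`: `∃ c₀ > 0`, for all `(x, r) ∈ D_e(F)` and all `σ : F → ℚ̄_p`
  with `(σ x, σ r)` `ρ`-far from the zeros of `N_c` (or from any `Z ⊇` them, e.g. `De.EphiC`),
  `c₀ ≤ ‖σ(N_c(x, r))‖`** — the `hbad₁` input of the place-wise κ-summation for the family, via
  `PadicEmbedding.sum_toNat_ord_mul_logNorm_le_of_forall_embedding`, at the finitely many bad places
  `S_bad(e, c, B)` of the W5 coordinator's (R-a′) contract.

Theorems only (0 defs, 0 named facts); classical `p`-adic compactness bookkeeping. Nothing here bears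
on the disputed parts of the abc-iut corpus ([GenEll] is refereed and granted by all sides).
-/

noncomputable section

open Metric

namespace Literature.NumberTheory.DiophantineGeometry.GenEll

namespace DePadicC

/-! ## Ultrametric growth of `N_c = −s³ + c·((k+1)r^{k+2} − 2r^{3k+3})` on `D_e` -/

section Growth

variable {E : Type*} [NormedField E] [IsUltrametricDist E]

/-- On `D_e : r^{2k+1} = x(1 − x)` over an ultrametric field with `‖2‖ ≥ 1/2` (e.g. `ℚ̄_p`), for
`c ≠ 0`, a point with `‖r‖ > max 4 ‖c‖⁻¹` has `‖N_c‖ > 1`,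
`N_c = −(1−2x)³ + c·((k+1)r^{k+2} − 2r^{3k+3})`: the term `2c·r^{3k+3}` strictly dominates.
Contrapositive form: `‖N_c‖ ≤ 1 ⇒ ‖r‖ ≤ max 4 ‖c‖⁻¹` (twin of `DePadic.norm_snd_le_four`).
[cite: MochizukiGenEll2010, Thm 2.1 proof p.12] -/
theorem norm_snd_le (h2 : (1 : ℝ) / 2 ≤ ‖(2 : E)‖) (k : ℕ) {c : E} (hc : c ≠ 0) {x r : E}
    (hcv : r ^ (2 * k + 1) = x * (1 - x))
    (hN : ‖-(1 - 2 * x) ^ 3 + c * (((k : E) + 1) * r ^ (k + 2) - 2 * r ^ (3 * k + 3))‖ ≤ 1) :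
    ‖r‖ ≤ max 4 ‖c‖⁻¹ := by
  by_contra hr
  rw [not_le, max_lt_iff] at hr
  obtain ⟨hr, hrc⟩ := hr
  have hcpos : 0 < ‖c‖ := norm_pos_iff.mpr hc
  have hrc1 : 1 < ‖c‖ * ‖r‖ := by
    have h := mul_lt_mul_of_pos_left hrc hcpos
    rwa [mul_inv_cancel₀ hcpos.ne'] at h
  have h2le : ‖(2 : E)‖ ≤ 1 := by simpa using IsUltrametricDist.norm_natCast_le_one E 2
  have h2pos : 0 < ‖(2 : E)‖ := lt_of_lt_of_le (by norm_num) h2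
  have hr1 : 1 ≤ ‖r‖ := by linarith
  have hr0 : 0 < ‖r‖ := by linarith
  -- `s² = 1 − 4r^e`, `‖s‖² = ‖4r^e‖ = ‖2‖²‖r‖^e`
  have hs2 : (1 - 2 * x) ^ 2 = 1 + -(4 * r ^ (2 * k + 1)) := by linear_combination 4 * hcv
  have h4 : (4 : E) = 2 ^ 2 := by norm_num
  have hnorm4r : ‖-(4 * r ^ (2 * k + 1))‖ = ‖(2 : E)‖ ^ 2 * ‖r‖ ^ (2 * k + 1) := by
    rw [norm_neg, norm_mul, h4, norm_pow, norm_pow]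
  have hbig : 1 < ‖(2 : E)‖ ^ 2 * ‖r‖ ^ (2 * k + 1) := by
    have hA : (1 : ℝ) / 4 ≤ ‖(2 : E)‖ ^ 2 := by nlinarith
    have hB : (4 : ℝ) < ‖r‖ ^ (2 * k + 1) :=
      lt_of_lt_of_le hr (le_self_pow₀ hr1 (by omega))
    nlinarith
  have hs_sq : ‖1 - 2 * x‖ ^ 2 = ‖(2 : E)‖ ^ 2 * ‖r‖ ^ (2 * k + 1) := by
    rw [← norm_pow, hs2, IsUltrametricDist.norm_add_eq_max_of_norm_ne_norm, norm_one, hnorm4r,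
      max_eq_right hbig.le]
    rw [norm_one, hnorm4r]
    exact hbig.ne
  -- the three terms
  set A := ‖-(1 - 2 * x) ^ 3‖ with hA
  set B₀ := ‖(2 : E) * r ^ (3 * k + 3)‖ with hB₀
  set C := ‖((k : E) + 1) * r ^ (k + 2)‖ with hC
  have hB₀val : B₀ = ‖(2 : E)‖ * ‖r‖ ^ (3 * k + 3) := by rw [hB₀, norm_mul, norm_pow]
  have hAval : A ^ 2 = ‖(2 : E)‖ ^ 6 * ‖r‖ ^ (6 * k + 3) := by
    rw [hA, norm_neg, norm_pow, ← pow_mul, show 3 * 2 = 2 * 3 by norm_num, pow_mul, hs_sq]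
    ring
  have hCB : C < B₀ := by
    have hC1 : C ≤ ‖r‖ ^ (k + 2) := by
      rw [hC, norm_mul, norm_pow]
      have hk : ‖((k : E) + 1)‖ ≤ 1 := by simpa using IsUltrametricDist.norm_natCast_le_one E (k + 1)
      calc ‖(k : E) + 1‖ * ‖r‖ ^ (k + 2) ≤ 1 * ‖r‖ ^ (k + 2) :=
            mul_le_mul_of_nonneg_right hk (by positivity)
        _ = ‖r‖ ^ (k + 2) := one_mul _
    refine lt_of_le_of_lt hC1 ?_
    have hD : (1 : ℝ) < ‖(2 : E)‖ * ‖r‖ ^ (2 * k + 1) := by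
      have : (4 : ℝ) < ‖r‖ ^ (2 * k + 1) := lt_of_lt_of_le hr (le_self_pow₀ hr1 (by omega))
      nlinarith
    have hpos : 0 < ‖r‖ ^ (k + 2) := by positivity
    have hsplit : ‖(2 : E)‖ * ‖r‖ ^ (3 * k + 3) = (‖(2 : E)‖ * ‖r‖ ^ (2 * k + 1)) * ‖r‖ ^ (k + 2) := by
      ring
    rw [hB₀val, hsplit]
    exact lt_mul_of_one_lt_left hpos hD
  -- ultrametric: the dominant term wins inside the bracket
  have hinner : ‖((k : E) + 1) * r ^ (k + 2) - 2 * r ^ (3 * k + 3)‖ = B₀ := by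
    rw [sub_eq_add_neg, IsUltrametricDist.norm_add_eq_max_of_norm_ne_norm, norm_neg,
      max_eq_right hCB.le]
    rw [norm_neg]; exact hCB.ne
  set B := ‖c * (((k : E) + 1) * r ^ (k + 2) - 2 * r ^ (3 * k + 3))‖ with hB
  have hBval : B = ‖c‖ * (‖(2 : E)‖ * ‖r‖ ^ (3 * k + 3)) := by rw [hB, norm_mul, hinner, hB₀val]
  have hB0 : 0 ≤ B := norm_nonneg _
  have hAB : A < B := by
    have hsq : A ^ 2 < B ^ 2 := by
      rw [hAval, hBval]
      have h24 : ‖(2 : E)‖ ^ 4 ≤ 1 := pow_le_one₀ (norm_nonneg _) h2le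
      have hpos : 0 < ‖(2 : E)‖ ^ 2 * ‖r‖ ^ (6 * k + 3) := by positivity
      have hcr2 : 1 < (‖c‖ * ‖r‖) ^ 2 := by nlinarith
      have hcr3 : 1 < (‖c‖ * ‖r‖) ^ 2 * ‖r‖ := by nlinarith
      calc ‖(2 : E)‖ ^ 6 * ‖r‖ ^ (6 * k + 3)
          = (‖(2 : E)‖ ^ 2 * ‖r‖ ^ (6 * k + 3)) * ‖(2 : E)‖ ^ 4 := by ring
        _ ≤ (‖(2 : E)‖ ^ 2 * ‖r‖ ^ (6 * k + 3)) * 1 := mul_le_mul_of_nonneg_left h24 hpos.le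
        _ < (‖(2 : E)‖ ^ 2 * ‖r‖ ^ (6 * k + 3)) * ((‖c‖ * ‖r‖) ^ 2 * ‖r‖) :=
            mul_lt_mul_of_pos_left hcr3 hpos
        _ = (‖c‖ * (‖(2 : E)‖ * ‖r‖ ^ (3 * k + 3))) ^ 2 := by ring
    exact lt_of_pow_lt_pow_left₀ 2 hB0 hsq
  have hN' : ‖-(1 - 2 * x) ^ 3 + c * (((k : E) + 1) * r ^ (k + 2) - 2 * r ^ (3 * k + 3))‖ = B := by
    rw [IsUltrametricDist.norm_add_eq_max_of_norm_ne_norm, max_eq_right hAB.le]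
    exact hAB.ne
  have hB1 : 1 < B := by
    rw [hBval]
    have hr2 : (16 : ℝ) < ‖r‖ ^ (3 * k + 2) := by
      have h16 : (16 : ℝ) < ‖r‖ ^ 2 := by nlinarith
      exact lt_of_lt_of_le h16 (pow_le_pow_right₀ hr1 (by omega))
    have h1 : 1 < ‖(2 : E)‖ * ‖r‖ ^ (3 * k + 2) := by nlinarith
    calc (1 : ℝ) = 1 * 1 := by ring
      _ < (‖c‖ * ‖r‖) * (‖(2 : E)‖ * ‖r‖ ^ (3 * k + 2)) :=
          mul_lt_mul'' hrc1 h1 zero_le_one zero_le_one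
      _ = ‖c‖ * (‖(2 : E)‖ * ‖r‖ ^ (3 * k + 3)) := by ring
  rw [hN'] at hN
  exact absurd hN (not_le.mpr hB1)

/-- On `D_e`, `‖r‖ ≤ R` with `1 ≤ R` forces `‖x‖ ≤ R^{2k+1}` (ultrametric: `‖x‖ > 1 ⇒ ‖x(1−x)‖ = ‖x‖²`;
twin of `DePadic.norm_fst_le` with the radius as a parameter). [cite: MochizukiGenEll2010, Thm 2.1 proof p.12] -/
theorem norm_fst_le (k : ℕ) {x r : E} (hcv : r ^ (2 * k + 1) = x * (1 - x)) {R : ℝ} (hR : 1 ≤ R)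
    (hr : ‖r‖ ≤ R) : ‖x‖ ≤ R ^ (2 * k + 1) := by
  have hR1 : (1 : ℝ) ≤ R ^ (2 * k + 1) := one_le_pow₀ hR
  rcases le_or_gt ‖x‖ 1 with hx | hx
  · exact hx.trans hR1
  · have h1x : ‖1 - x‖ = ‖x‖ := by
      rw [sub_eq_add_neg, IsUltrametricDist.norm_add_eq_max_of_norm_ne_norm, norm_one, norm_neg,
        max_eq_right hx.le]
      rw [norm_one, norm_neg]; exact hx.ne
    have hxx : ‖x‖ * ‖x‖ = ‖r‖ ^ (2 * k + 1) := by
      calc ‖x‖ * ‖x‖ = ‖x‖ * ‖1 - x‖ := by rw [h1x]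
        _ = ‖x * (1 - x)‖ := (norm_mul _ _).symm
        _ = ‖r‖ ^ (2 * k + 1) := by rw [← hcv, norm_pow]
    have hre : ‖r‖ ^ (2 * k + 1) ≤ R ^ (2 * k + 1) :=
      pow_le_pow_left₀ (norm_nonneg _) hr _
    nlinarith

end Growth

/-! ## The separation lemma over `ℚ̄_p` -/

variable (p : ℕ) [Fact p.Prime]

/-- `‖2‖ ≥ 1/2` in `ℚ̄_p` (`= 1/2` for `p = 2`, `= 1` otherwise). [folklore] -/
private theorem half_le_norm_two : (1 : ℝ) / 2 ≤ ‖(2 : PadicAlgCl p)‖ := by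
  have h : ((2 : ℕ) : PadicAlgCl p) = algebraMap ℚ_[p] (PadicAlgCl p) ((2 : ℕ) : ℚ_[p]) := by
    rw [map_natCast]
  have h2 : ‖(2 : PadicAlgCl p)‖ = ‖((2 : ℕ) : ℚ_[p])‖ := by
    rw [show (2 : PadicAlgCl p) = ((2 : ℕ) : PadicAlgCl p) by norm_num, h, norm_algebraMap']
  rw [h2]
  by_cases hp : p = 2
  · subst hp
    rw [show ((2 : ℕ) : ℚ_[2]) = (2 : ℕ) by rfl, Padic.norm_p]
    norm_num
  · have : ‖((2 : ℕ) : ℚ_[p])‖ = 1 := by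
      rw [Padic.norm_natCast_eq_one_iff]
      exact (Nat.coprime_primes (Fact.out : p.Prime) Nat.prime_two).mpr hp
    rw [this]; norm_num

/-- **`p`-adic separation from the ramification locus of `t_c` bounds `‖N_c‖_p` below, one finite
extension at a time.** For `c ∈ ℚ̄_p^×`, a finite extension `L ⊆ ℚ̄_p` of `ℚ_p` and `ρ > 0` there is
`c₀ > 0` such that every point `P = (x, r) ∈ D_e(L)` (`r^{2k+1} = x(1−x)`) all of whose `ρ`-neighbours
(sup-distance in `ℚ̄_p × ℚ̄_p`) avoid the zeros of `N_c = −(1−2x)³ + c·((k+1)r^{k+2} − 2r^{3k+3})` on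
`D_e(ℚ̄_p)` — the ramification points of `t_c` — satisfies `c₀ ≤ ‖N_c(P)‖`. Proof: the points of
`D_e(L)` with `‖N_c‖ ≤ 1` form a compact set (`L` is locally compact and `‖N_c‖ ≤ 1 ⇒
‖r‖ ≤ max 4 ‖c‖⁻¹`, `‖x‖ ≤ (max 4 ‖c‖⁻¹)^e`), on whose closed subset of `ρ`-separated points the
continuous function `‖N_c‖` does not vanish (twin of `DePadic.exists_pos_le_norm_of_separated`).
[cite: MochizukiGenEll2010, Thm 2.1 proof p.12] -/
theorem exists_pos_le_norm_of_separated (k : ℕ) {c : PadicAlgCl p} (hc : c ≠ 0)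
    (L : IntermediateField ℚ_[p] (PadicAlgCl p)) [FiniteDimensional ℚ_[p] L] {ρ : ℝ} (hρ : 0 < ρ) :
    ∃ c₀ : ℝ, 0 < c₀ ∧ ∀ P : PadicAlgCl p × PadicAlgCl p, P.1 ∈ L → P.2 ∈ L →
      P.2 ^ (2 * k + 1) = P.1 * (1 - P.1) →
      (∀ Q : PadicAlgCl p × PadicAlgCl p, Q.2 ^ (2 * k + 1) = Q.1 * (1 - Q.1) →
        -(1 - 2 * Q.1) ^ 3 + c * (((k : PadicAlgCl p) + 1) * Q.2 ^ (k + 2) - 2 * Q.2 ^ (3 * k + 3))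
          = 0 → ρ ≤ dist P Q) →
      c₀ ≤ ‖-(1 - 2 * P.1) ^ 3 +
        c * (((k : PadicAlgCl p) + 1) * P.2 ^ (k + 2) - 2 * P.2 ^ (3 * k + 3))‖ := by
  classical
  haveI : ProperSpace L := FiniteDimensional.proper ℚ_[p] L
  set Nf : PadicAlgCl p × PadicAlgCl p → PadicAlgCl p := fun Q =>
    -(1 - 2 * Q.1) ^ 3 + c * (((k : PadicAlgCl p) + 1) * Q.2 ^ (k + 2) - 2 * Q.2 ^ (3 * k + 3))
    with hNf
  let ι : L × L → PadicAlgCl p × PadicAlgCl p := fun P => ((P.1 : PadicAlgCl p), (P.2 : PadicAlgCl p))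
  have hι : Continuous ι :=
    (continuous_subtype_val.comp continuous_fst).prodMk (continuous_subtype_val.comp continuous_snd)
  have hNc : Continuous Nf := by simp only [hNf]; fun_prop
  let Z : Set (PadicAlgCl p × PadicAlgCl p) := {Q | Q.2 ^ (2 * k + 1) = Q.1 * (1 - Q.1) ∧ Nf Q = 0}
  let T : Set (L × L) := {P | (ι P).2 ^ (2 * k + 1) = (ι P).1 * (1 - (ι P).1) ∧ ‖Nf (ι P)‖ ≤ 1 ∧
    ∀ Q ∈ Z, ρ ≤ dist (ι P) Q}
  -- `T` is closed
  have hTclosed : IsClosed T := by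
    refine (isClosed_eq ?_ ?_).inter ((isClosed_le (continuous_norm.comp (hNc.comp hι))
      continuous_const).inter ?_)
    · exact (continuous_snd.comp hι).pow _
    · exact (continuous_fst.comp hι).mul (continuous_const.sub (continuous_fst.comp hι))
    · have hcl : IsClosed (⋂ Q ∈ Z, {P : L × L | ρ ≤ dist (ι P) Q}) :=
        isClosed_biInter fun Q _ => isClosed_le continuous_const (hι.dist continuous_const)
      convert hcl using 1
      ext P
      simp only [Set.mem_iInter, Set.mem_setOf_eq]
      rfl
  -- `T` is bounded (`‖N_c‖ ≤ 1 ⇒ ‖r‖ ≤ M ⇒ ‖x‖ ≤ M^e`, `M = max 4 ‖c‖⁻¹`)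
  set M : ℝ := max 4 ‖c‖⁻¹ with hM
  have hM1 : (1 : ℝ) ≤ M := le_trans (by norm_num) (le_max_left _ _)
  have hTbdd : Bornology.IsBounded T := by
    refine (isBounded_closedBall (x := (0 : L × L)) (r := M ^ (2 * k + 1))).subset ?_
    intro P hP
    rw [mem_closedBall, dist_zero_right]
    obtain ⟨hcv, hN1, -⟩ := hP
    have hrM : ‖(P.2 : PadicAlgCl p)‖ ≤ M := norm_snd_le (half_le_norm_two p) k hc hcv hN1
    have hx : ‖(P.1 : PadicAlgCl p)‖ ≤ M ^ (2 * k + 1) := norm_fst_le k hcv hM1 hrM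
    have hMM : M ≤ M ^ (2 * k + 1) := le_self_pow₀ hM1 (by omega)
    rw [Prod.norm_def]
    exact max_le hx (hrM.trans hMM)
  have hTcpt : IsCompact T := isCompact_of_isClosed_isBounded hTclosed hTbdd
  -- the positive function `‖N_c‖`
  let g : L × L → ℝ := fun P => ‖Nf (ι P)‖
  have hg : Continuous g := continuous_norm.comp (hNc.comp hι)
  have hgpos : ∀ P ∈ T, 0 < g P := by
    intro P hP
    obtain ⟨hcv, -, hsep⟩ := hP
    by_contra h0
    have h0' : Nf (ι P) = 0 := by
      have : ‖Nf (ι P)‖ = 0 := le_antisymm (not_lt.mp h0) (norm_nonneg _)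
      exact norm_eq_zero.mp this
    have := hsep (ι P) ⟨hcv, h0'⟩
    rw [dist_self] at this
    exact absurd this (not_le.mpr hρ)
  by_cases hT : T.Nonempty
  · obtain ⟨P₀, hP₀, hmin⟩ := hTcpt.exists_isMinOn hT hg.continuousOn
    refine ⟨min 1 (g P₀), lt_min one_pos (hgpos P₀ hP₀), fun P h1 h2 hcv hsep => ?_⟩
    set P' : L × L := (⟨P.1, h1⟩, ⟨P.2, h2⟩) with hP'
    have hιP : ι P' = P := rfl
    by_cases hle : ‖Nf P‖ ≤ 1
    · have hP'T : P' ∈ T := by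
        refine ⟨?_, ?_, fun Q hQ => ?_⟩
        · rw [hιP]; exact hcv
        · rw [hιP]; exact hle
        · rw [hιP]; exact hsep Q hQ.1 hQ.2
      calc min 1 (g P₀) ≤ g P₀ := min_le_right _ _
        _ ≤ g P' := hmin hP'T
        _ = ‖Nf P‖ := by simp only [g, hιP]
    · exact (min_le_left _ _).trans (le_of_lt (not_le.mp hle))
  · refine ⟨1, one_pos, fun P h1 h2 hcv hsep => ?_⟩
    by_contra hlt
    rw [not_le] at hlt
    exact hT ⟨(⟨P.1, h1⟩, ⟨P.2, h2⟩), hcv, hlt.le, fun Q hQ => hsep Q hQ.1 hQ.2⟩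

/-- **The `p`-adic separation lemma for the family `t_c`, number fields of bounded degree** (GenEllTwo
package W5b, nonarchimedean half, `c`-parametric; the input `hbad₁` of the place-wise κ-summation
after the embeddings-to-places dictionary
`PadicEmbedding.sum_toNat_ord_mul_logNorm_le_of_forall_embedding`): for every prime `p`, `k`,
`c ∈ ℚ^×`, degree bound `d` and `ρ > 0` there is `c₀ > 0` such that for every number field `F` with
`[F:ℚ] ≤ d`, every `(x, r) ∈ D_e(F)` and every embedding `σ : F → ℚ̄_p` whose image point
`(σ x, σ r)` is `ρ`-far from the zeros of `N_c` on `D_e(ℚ̄_p)`, `c₀ ≤ ‖σ(N_c(x, r))‖`,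
`N_c = −(1−2x)³ + c·((k+1)r^{k+2} − 2r^{3k+3})`. (All `ℚ̄_p`-conjugates in degree `≤ d` lie in one
finite `L/ℚ_p`, `exists_intermediateField_forall_conj_mem`; twin of
`DePadic.exists_pos_le_norm_embedding_of_separated`.) [cite: MochizukiGenEll2010, Thm 2.1 proof p.12] -/
theorem exists_pos_le_norm_embedding_of_separated (k d : ℕ) {c : ℚ} (hc : c ≠ 0) {ρ : ℝ}
    (hρ : 0 < ρ) :
    ∃ c₀ : ℝ, 0 < c₀ ∧ ∀ (F : Type) [Field F] [NumberField F], Module.finrank ℚ F ≤ d →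
      ∀ (x r : F), r ^ (2 * k + 1) = x * (1 - x) → ∀ σ : F →+* PadicAlgCl p,
        (∀ Q : PadicAlgCl p × PadicAlgCl p, Q.2 ^ (2 * k + 1) = Q.1 * (1 - Q.1) →
          -(1 - 2 * Q.1) ^ 3 + (c : PadicAlgCl p) *
            (((k : PadicAlgCl p) + 1) * Q.2 ^ (k + 2) - 2 * Q.2 ^ (3 * k + 3)) = 0 →
          ρ ≤ dist (σ x, σ r) Q) →
        c₀ ≤ ‖σ (-(1 - 2 * x) ^ 3 + (c : F) * (((k : F) + 1) * r ^ (k + 2) - 2 * r ^ (3 * k + 3)))‖ := by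
  obtain ⟨L, hLfd, hL⟩ := exists_intermediateField_forall_conj_mem p d
  haveI : FiniteDimensional ℚ_[p] L := hLfd
  have hc' : (c : PadicAlgCl p) ≠ 0 := by exact_mod_cast hc
  obtain ⟨c₀, hc₀, h⟩ := exists_pos_le_norm_of_separated p k hc' L hρ
  refine ⟨c₀, hc₀, fun F _ _ hF x r hcv σ hsep => ?_⟩
  have hcv' : (σ r) ^ (2 * k + 1) = σ x * (1 - σ x) := by
    have := congrArg σ hcv
    simpa [map_pow, map_mul, map_sub, map_one] using this
  have hmap : σ (-(1 - 2 * x) ^ 3 + (c : F) * (((k : F) + 1) * r ^ (k + 2) - 2 * r ^ (3 * k + 3))) =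
      -(1 - 2 * σ x) ^ 3 + (c : PadicAlgCl p) *
        (((k : PadicAlgCl p) + 1) * (σ r) ^ (k + 2) - 2 * (σ r) ^ (3 * k + 3)) := by
    simp [map_sub, map_add, map_mul, map_pow, map_neg, map_ofNat, map_natCast, map_ratCast]
  rw [hmap]
  exact h (σ x, σ r) (hL F hF σ x) (hL F hF σ r) hcv' hsep

/-- The same with separation from ANY set `Z ⊇` the zeros of `N_c` on `D_e(ℚ̄_p)` — e.g. the whole
preimage `E = t_c⁻¹(B) ⊇ R_{t_c}` of the package (`De.EphiC`; the inclusion is the consumer's input).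
[cite: MochizukiGenEll2010, Thm 2.1 proof p.12] -/
theorem exists_pos_le_norm_embedding_of_separated_of_subset (k d : ℕ) {c : ℚ} (hc : c ≠ 0) {ρ : ℝ}
    (hρ : 0 < ρ) :
    ∃ c₀ : ℝ, 0 < c₀ ∧ ∀ (Z : Set (PadicAlgCl p × PadicAlgCl p)),
      (∀ Q : PadicAlgCl p × PadicAlgCl p, Q.2 ^ (2 * k + 1) = Q.1 * (1 - Q.1) →
        -(1 - 2 * Q.1) ^ 3 + (c : PadicAlgCl p) *
          (((k : PadicAlgCl p) + 1) * Q.2 ^ (k + 2) - 2 * Q.2 ^ (3 * k + 3)) = 0 →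
        Q ∈ Z) →
      ∀ (F : Type) [Field F] [NumberField F], Module.finrank ℚ F ≤ d →
        ∀ (x r : F), r ^ (2 * k + 1) = x * (1 - x) → ∀ σ : F →+* PadicAlgCl p,
          (∀ Q ∈ Z, ρ ≤ dist (σ x, σ r) Q) →
          c₀ ≤ ‖σ (-(1 - 2 * x) ^ 3 + (c : F) * (((k : F) + 1) * r ^ (k + 2) - 2 * r ^ (3 * k + 3)))‖ := by
  obtain ⟨c₀, hc₀, h⟩ := exists_pos_le_norm_embedding_of_separated p k d hc hρ
  exact ⟨c₀, hc₀, fun Z hZ F _ _ hF x r hcv σ hsep =>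
    h F hF x r hcv σ fun Q hQ hN => hsep Q (hZ Q hQ hN)⟩

end DePadicC

end Literature.NumberTheory.DiophantineGeometry.GenEll

end
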